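/-
Copyright (c) 2026 the pub-hodgecm-mathlib formalisation cell (harness21).  Prover seat hodgecm-mathlib-R90-C133-p02 (g2), Track B ∕ R90-TF, h413 = `stmt-HodgeConjecture-24833`,
R90-TF section S8 «ContSpec-n½» (S8-R221 «finish `hTRANSτ` OF RECORD»; JUNCTION RULE «rows byte-identical across seats»): the NORMAL-FORM-FREE twin of ★ p864581 — `hEXI` from
K2E1-p11 (g5)'s exports row `hTEXP` EXACTLY AS PRINTED in ★ `R90S8ResGMidRowsOfTauExportsU3` §2 (no `MeromorphicNFOn` clause), the pole-ledger row `hPL` and the residue row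
`hRES`: the exported continuation is REPAIRED at its removable candidate poles of `{1 < Re} ∖ {3∕2}` (value := punctured limit; Riemann's theorem, Mathlib
`Complex.differentiableOn_update_limUnder_of_bddAbove`), which gives ★ D1's slit-plane holomorphy and the pole letter at `3∕2` WITHOUT the normal-form clause.
-/
import Summits.HodgeConjecture.HodgeConjecture.Theorems.R90S8ResGMidAtomTransOfRecordU3   -- ★ p864581 (this seat): `hTRANSτ_of_exports_of_arch` ∕ `hDISC_of_exports_of_arch` (★ p864527), row shapes; brings ★ τ-DEFS, ★ D1
import Mathlib.Analysis.Complex.RemovableSingularity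
import HarnessLib

/-!
# S8 (R)′ road — `R90S8ResGMidAtomTransOfRecordRepairedU3`: `hEXI` ∕ `hTRANSτ` ∕ `hDISC` OF RECORD FROM {`hTEXP` (p11's bytes), `hPL`, `hRES`} — THE REPAIRED CONTINUATION

Track B ∕ R90-TF, crux h413 = `stmt-HodgeConjecture-24833`, route of record `HCCMUnconditional`; cell `hodgecm-mathlib`, R90-TF section S8 «ContSpec-n½ ∕ ResidualSpectrum», socket (R)
(B ED. 7 :337) ← ★ p864333 ← ★ p864527 `hDISC_of_exports_of_arch (hW1) (hEXI) (hARCH)` ← THIS FILE `hEXI_of_exportsRow (hTEXP) (hPL) (hRES)`.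
THEOREMS ONLY (no `def`, no `instance`, no `notation`, no named-fact hypothesis, no `sorry`; default heartbeats); lane `--supports stmt-HodgeConjecture-24833 --as helper` (count-neutral).
CLOSES NO SOCKET (OF-RECORD ≠ payment).

WHY THIS TWIN.  ★ p864581 read the exports row WITH the head's normal-form clause (`hTEXPnf`), because ★ p863972's pole ledger uses normal form at the removable candidates.  The row the
T estate closes (K2E1-p12 (g6) `R90S8ResGMidRowsOfTauExportsClosedU3`) is p11's `hTEXP` WITHOUT that clause.  Here the clause is made unnecessary: given `hTEXP`'s `(Ec, P)` and the
ledger's bounds, the REPAIRED family `Ec♯ z g := lim_{w → z, w ≠ z} Ec w g` at the candidates `z ∈ P`, `1 < Re z`, `z ≠ 3∕2` (and `Ec z g` elsewhere) is holomorphic in `z` on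
`{1 < Re} ∖ {3∕2}` for every `g` (Riemann: bounded and holomorphic on a punctured disc ⇒ the limit-update is holomorphic; off `P` nothing changes since `P` is closed), still equals
`E(flat(ψ, z))` on `{2 < Re}` (`P ⊆ {Re ≤ 2}`), and `(z − 3∕2)·Ec♯ z g = (z − 3∕2)·Ec z g` near `3∕2` is bounded and holomorphic on a punctured disc, so its limit-update is the pole
letter `Fp g`, analytic at `3∕2`.  `hPL` is consumed at the ORIGINAL `(Ec, P)`; `hRES` (universally quantified over continuations) at `Ec♯`.
* §1 (generic, any parameter type `X`) `analyticAt_update_limUnder_of_eventually_bounded`, `differentiableOn_slit_of_repaired`, `exists_poleLetter_of_repaired`, `repaired_eq_of_two_lt_re`.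
* §2 **`hEXI_of_exportsRow (hTEXP) (hPL) (hRES)`** (any pair `(χ₁, χ₂)`; `hTEXP` = p11's bytes) ⊢ ★ p864527's `hEXI` BYTE FOR BYTE.
* §3 **`hTRANSτ_of_exportsRow_of_arch (hμu) (hTEXP) (hPL) (hRES) (harch)`**, **`hDISC_of_exportsRow_of_arch (hW1) (hTEXP) (hPL) (hRES) (hARCH)`** (∀-closed; `hDISC` bytes VERBATIM).
THE LEDGER after this file: `hDISC` = ★ ∘ {`hW1` (K2E1-p10), `hTEXP` (p11's row — ★ by K2E1-p12's closed row modulo its printed (L1)∕(L2)), `hPL` (T's Maass–Selberg column), `hRES`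
(T's residue column), `hARCH` = (T_∞) (L)} — every row now in the OWNER's own bytes.
HONEST LABEL: HC_CM is proved only modulo the 7 printed citations (2 remaining named inputs: hLiu418 = `stmt-HodgeConjecture-24832`, h413 = `stmt-HodgeConjecture-24833`) until
rung 0 closes; REL ≠ ★ ≠ BUILT; OF-RECORD ≠ payment; pays no socket; count-neutral.

## References
* [Conway1978] J. B. Conway, *Functions of One Complex Variable* (2nd ed., 1978), V §1 (Riemann's removable singularity theorem).
* [MoeglinWaldspurger1995] C. Mœglin, J.-L. Waldspurger, *Spectral Decomposition and Eisenstein Series* (1995), IV.1.9–IV.1.11, V.3.13.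
* [BernsteinLapid2019] J. Bernstein, E. Lapid, *On the meromorphic continuation of Eisenstein series*, J. Amer. Math. Soc. 37 (2024), Thm 2.3, §4.
-/

set_option autoImplicit false
set_option linter.dupNamespace false  -- the mandated namespace `…HodgeConjecture.HodgeConjecture.R90.S8` (LEAD #1 L1) repeats the summit's segment

noncomputable section

open MeasureTheory Measure Set Filter Topology NumberField IsDedekindDomain ContRepresentation Function
open Literature.NumberTheory Literature.NumberTheory.Automorphic Literature.NumberTheory.Automorphic.UnitaryGroup Literature.NumberTheory.GaloisRepresentations AdelicGroupData
open Literature.NumberTheory.Automorphic.Arthur2013.Leaves.TECR Literature.NumberTheory.Rogawski1990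
open Summit.HodgeConjecture.HodgeConjecture.Cruxes.H413.K2E1BorelEisensteinU
open Summit.HodgeConjecture.HodgeConjecture.Cruxes.H413.K2E1CharacterEisensteinU3PairDefs
open Summit.HodgeConjecture.HodgeConjecture.Cruxes.H413.K2E1ChiSectionSpaceU3PairDefs
open scoped ENNReal NNReal

namespace Summit.HodgeConjecture.HodgeConjecture.R90.S8

/-! ## §1 Riemann's removable singularity theorem for a family, at the candidate poles (generic parameter type) -/

section Generic

variable {X : Type*}

/-- **RIEMANN'S THEOREM, ANALYTIC FORM**: a function `ℂ → ℂ` differentiable and bounded on a punctured neighbourhood of `c`, updated at `c` by its punctured limit, is ANALYTIC at `c`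
(Mathlib `Complex.differentiableOn_update_limUnder_of_bddAbove` on the neighbourhood where both hold, then `DifferentiableOn.analyticAt`). [cite: Conway1978, V §1] -/
theorem analyticAt_update_limUnder_of_eventually_bounded {f : ℂ → ℂ} {c : ℂ}
    (hda : ∀ᶠ z in 𝓝[≠] c, DifferentiableAt ℂ f z) (hb : ∃ C : ℝ, ∀ᶠ z in 𝓝[≠] c, ‖f z‖ ≤ C) :
    AnalyticAt ℂ (update f c (limUnder (𝓝[≠] c) f)) c := by
  obtain ⟨C, hC⟩ := hb
  have hs : {z : ℂ | z ≠ c → DifferentiableAt ℂ f z ∧ ‖f z‖ ≤ C} ∈ 𝓝 c := eventually_nhdsWithin_iff.1 (hda.and hC)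
  have H := Complex.differentiableOn_update_limUnder_of_bddAbove hs (fun z hz => (hz.1 hz.2).1.differentiableWithinAt)
    ⟨C, by rintro _ ⟨z, hz, rfl⟩; exact (hz.1 hz.2).2⟩
  exact H.analyticAt hs

/-- **THE REPAIRED FAMILY IS HOLOMORPHIC ON THE SLIT PLANE `{1 < Re} ∖ {3∕2}`**: `E` analytic off a closed co-discrete `P`, bounded near every candidate `z₀ ∈ P` with `1 < Re z₀`,
`z₀ ≠ 3∕2`; `E′` agrees with `E` off those candidates and equals the punctured limit of `E · g` at them ⇒ `E′ · g` is holomorphic on the slit plane for every `g`. [cite: Conway1978, V §1]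
[cite: MoeglinWaldspurger1995, IV.1.11] -/
theorem differentiableOn_slit_of_repaired (E E' : ℂ → X → ℂ) (P : Set ℂ) (hPc : IsClosed P) (hPcd : ∀ z₀ : ℂ, ∀ᶠ s in 𝓝[≠] z₀, s ∉ P)
    (hEan : ∀ g (z : ℂ), z ∉ P → AnalyticAt ℂ (fun z => E z g) z)
    (hbdd : ∀ g, ∀ z₀ ∈ P, 1 < z₀.re → z₀ ≠ (3 : ℂ) / 2 → ∃ C : ℝ, ∀ᶠ z in 𝓝[≠] z₀, ‖E z g‖ ≤ C)
    (hoff : ∀ z g, ¬ (z ∈ P ∧ 1 < z.re ∧ z ≠ (3 : ℂ) / 2) → E' z g = E z g)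
    (hon : ∀ z g, z ∈ P → 1 < z.re → z ≠ (3 : ℂ) / 2 → E' z g = limUnder (𝓝[≠] z) (fun w => E w g)) :
    ∀ g, DifferentiableOn ℂ (fun z => E' z g) ({z : ℂ | 1 < z.re} \ (↑({(3 : ℂ) / 2} : Finset ℂ) : Set ℂ)) := by
  intro g z hz
  have hz1 : 1 < z.re := hz.1
  have hz32 : z ≠ (3 : ℂ) / 2 := fun h => hz.2 (by rw [h]; simp)
  by_cases hzP : z ∈ P
  · -- a candidate pole: `E′ · g` is the limit-update of `E · g` near `z`
    have hda : ∀ᶠ w in 𝓝[≠] z, DifferentiableAt ℂ (fun w => E w g) w := (hPcd z).mono fun w hw => (hEan g w hw).differentiableAt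
    have hup : DifferentiableAt ℂ (update (fun w => E w g) z (limUnder (𝓝[≠] z) fun w => E w g)) z :=
      (analyticAt_update_limUnder_of_eventually_bounded hda (hbdd g z hzP hz1 hz32)).differentiableAt
    have hev : (fun w => E' w g) =ᶠ[𝓝 z] update (fun w => E w g) z (limUnder (𝓝[≠] z) fun w => E w g) := by
      have h1 : ∀ᶠ w in 𝓝 z, w ≠ z → w ∉ P := eventually_nhdsWithin_iff.1 (hPcd z)
      filter_upwards [h1] with w hw
      by_cases hwz : w = z
      · subst hwz; rw [update_self]; exact hon _ g hzP hz1 hz32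
      · rw [update_of_ne hwz]; exact hoff _ g fun h => hw hwz h.1
    exact (hup.congr_of_eventuallyEq hev).differentiableWithinAt
  · -- off `P`: `E′ = E` near `z` (`P` closed), and `E · g` is analytic at `z`
    have hev : (fun w => E' w g) =ᶠ[𝓝 z] fun w => E w g := by
      filter_upwards [hPc.isOpen_compl.mem_nhds hzP] with w hw
      exact hoff w g fun h => hw h.1
    exact ((hEan g z hzP).differentiableAt.congr_of_eventuallyEq hev).differentiableWithinAt

/-- **THE POLE LETTER AT `3∕2` OF THE REPAIRED FAMILY**: if `(z − 3∕2)·E z g` is bounded near `3∕2` for every `g` (at most a simple pole), its limit-update `Fp g` is analytic at `3∕2` and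
agrees with `(z − 3∕2)·E′ z g` on a punctured neighbourhood (`E′ = E` there: no candidate of `P` near `3∕2` other than `3∕2`). [cite: Conway1978, V §1] [cite: MoeglinWaldspurger1995, IV.1.11] -/
theorem exists_poleLetter_of_repaired (E E' : ℂ → X → ℂ) (P : Set ℂ) (hPcd : ∀ z₀ : ℂ, ∀ᶠ s in 𝓝[≠] z₀, s ∉ P)
    (hEan : ∀ g (z : ℂ), z ∉ P → AnalyticAt ℂ (fun z => E z g) z)
    (hbdd32 : ∀ g, ∃ C : ℝ, ∀ᶠ z in 𝓝[≠] ((3 : ℂ) / 2), ‖(z - (3 : ℂ) / 2) * E z g‖ ≤ C)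
    (hoff : ∀ z g, ¬ (z ∈ P ∧ 1 < z.re ∧ z ≠ (3 : ℂ) / 2) → E' z g = E z g) :
    ∃ Fp : X → ℂ → ℂ, (∀ g, AnalyticAt ℂ (Fp g) ((3 : ℂ) / 2)) ∧ (∀ g, Fp g =ᶠ[𝓝[≠] ((3 : ℂ) / 2)] fun z => (z - (3 : ℂ) / 2) * E' z g) := by
  refine ⟨fun g => update (fun z => (z - (3 : ℂ) / 2) * E z g) ((3 : ℂ) / 2) (limUnder (𝓝[≠] ((3 : ℂ) / 2)) fun z => (z - (3 : ℂ) / 2) * E z g),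
    fun g => analyticAt_update_limUnder_of_eventually_bounded ((hPcd _).mono fun w hw =>
      ((differentiableAt_id.sub (differentiableAt_const _)).mul (hEan g w hw).differentiableAt)) (hbdd32 g), fun g => ?_⟩
  have h1 : ∀ᶠ w in 𝓝[≠] ((3 : ℂ) / 2), w ≠ (3 : ℂ) / 2 := self_mem_nhdsWithin
  filter_upwards [h1, hPcd ((3 : ℂ) / 2)] with w hw hwP
  rw [update_of_ne hw, hoff w g fun h => hwP h.1]

/-- The repaired family agrees with the original on `{2 < Re}` (`P ⊆ {Re ≤ 2}`), hence still continues `z ↦ E(flat(ψ, z))`. [cite: MoeglinWaldspurger1995, II.1.5] -/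
theorem repaired_eq_of_two_lt_re (E E' : ℂ → X → ℂ) (P : Set ℂ) (hPre : ∀ z ∈ P, z.re ≤ 2)
    (hoff : ∀ z g, ¬ (z ∈ P ∧ 1 < z.re ∧ z ≠ (3 : ℂ) / 2) → E' z g = E z g) {E₀ : ℂ → X → ℂ} (hE2 : ∀ z : ℂ, 2 < z.re → E z = E₀ z) :
    ∀ z : ℂ, 2 < z.re → E' z = E₀ z := fun z hz => by
  rw [← hE2 z hz]
  exact funext fun g => hoff z g fun h => absurd (hPre z h.1) (not_le.2 hz)

end Generic

/-! ## §2 `hEXI` from p11's exports row, the pole-ledger row and the residue row -/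

variable (L : Type) [Field L] [NumberField L] [IsCMField L]

/-- **★ p864527's `hEXI` FROM {`hTEXP` (K2E1-p11's bytes), `hPL`, `hRES`}** (any pair `(χ₁, χ₂)`): repair the exported continuation at the removable candidates (§1), read ★ D1's rows with
`Sp := {3∕2}`, take the pole letter of §1 and the residue class from `hRES` at the repaired family. [cite: MoeglinWaldspurger1995, IV.1.9–IV.1.11, V.3.13] [cite: Conway1978, V §1] -/
theorem hEXI_of_exportsRow (μ : Measure (quasiSplit (↥(maximalRealSubfield L)) L (IsCMField.complexConj L) 3).automorphicQuotient) {χ₁ : HeckeCharacter L} {χ₂ : ↥(TorusDict.torus (IsCMField.complexConj L)) →ₜ* ℂˣ}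
    (hTEXP : ∀ (U₀ : Subgroup ↥(finAdelic (↥(maximalRealSubfield L)) L (IsCMField.complexConj L) 3 ((StdForm.antidiagonal 3).over L))) (_ : IsTauLevel L U₀)
      (φ : (quasiSplit (↥(maximalRealSubfield L)) L (IsCMField.complexConj L) 3).Adelic → ℂ) (_ : φ ∈ chiSectionSpacePair χ₁ χ₂ (tauLevel L U₀) ((1 : ↥(tauLevel L U₀) →* ℂ) : ↥(tauLevel L U₀) → ℂ)) (_ : Continuous φ)
      (_ : IsArchFinite L φ),
      ∃ (Ec' : ℂ → (quasiSplit (↥(maximalRealSubfield L)) L (IsCMField.complexConj L) 3).Adelic → ℂ) (P : Set ℂ), IsClosed P ∧ (∀ z₀ : ℂ, ∀ᶠ s in 𝓝[≠] z₀, s ∉ P) ∧ (∀ z ∈ P, z.re ≤ 2) ∧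
        (∀ z : ℂ, 2 < z.re → Ec' z = eisensteinSeriesU (flatSectionU φ z)) ∧ (∀ g (z : ℂ), z ∉ P → AnalyticAt ℂ (fun z => Ec' z g) z) ∧
        (∀ z : ℂ, z ∉ P → Continuous (Ec' z)) ∧
        (∀ z₁ : ℂ, z₁ ∉ P → ∀ K : Set (quasiSplit (↥(maximalRealSubfield L)) L (IsCMField.complexConj L) 3).Adelic, IsCompact K → ∃ V ∈ 𝓝 z₁, ∃ M : ℝ, ∀ z ∈ V, ∀ g ∈ K, ‖Ec' z g‖ ≤ M))
    (hPL : ∀ (U₀ : Subgroup ↥(finAdelic (↥(maximalRealSubfield L)) L (IsCMField.complexConj L) 3 ((StdForm.antidiagonal 3).over L))) (_ : IsTauLevel L U₀)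
      (φ : (quasiSplit (↥(maximalRealSubfield L)) L (IsCMField.complexConj L) 3).Adelic → ℂ) (_ : φ ∈ chiSectionSpacePair χ₁ χ₂ (tauLevel L U₀) ((1 : ↥(tauLevel L U₀) →* ℂ) : ↥(tauLevel L U₀) → ℂ)) (_ : Continuous φ)
      (_ : IsArchFinite L φ)
      (Ec : ℂ → (quasiSplit (↥(maximalRealSubfield L)) L (IsCMField.complexConj L) 3).Adelic → ℂ) (P : Set ℂ), (∀ z : ℂ, 2 < z.re → Ec z = eisensteinSeriesU (flatSectionU φ z)) →
      (∀ z₀ : ℂ, ∀ᶠ s in 𝓝[≠] z₀, s ∉ P) → (∀ g (z : ℂ), z ∉ P → AnalyticAt ℂ (fun z => Ec z g) z) →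
      (∀ z₀ ∈ P, 1 < z₀.re → z₀ ≠ (3 : ℂ) / 2 → ∀ K : Set (quasiSplit (↥(maximalRealSubfield L)) L (IsCMField.complexConj L) 3).Adelic, IsCompact K → ∃ C : ℝ, ∀ᶠ z in 𝓝[≠] z₀, ∀ g ∈ K, ‖Ec z g‖ ≤ C) ∧
      (∀ g, ∃ C : ℝ, ∀ᶠ z in 𝓝[≠] ((3 : ℂ) / 2), ‖(z - (3 : ℂ) / 2) * Ec z g‖ ≤ C))
    (hRES : ∀ (U₀ : Subgroup ↥(finAdelic (↥(maximalRealSubfield L)) L (IsCMField.complexConj L) 3 ((StdForm.antidiagonal 3).over L))) (_ : IsTauLevel L U₀)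
      (φ : (quasiSplit (↥(maximalRealSubfield L)) L (IsCMField.complexConj L) 3).Adelic → ℂ) (_ : φ ∈ chiSectionSpacePair χ₁ χ₂ (tauLevel L U₀) ((1 : ↥(tauLevel L U₀) →* ℂ) : ↥(tauLevel L U₀) → ℂ)) (_ : Continuous φ)
      (_ : IsArchFinite L φ)
      (Ec : ℂ → (quasiSplit (↥(maximalRealSubfield L)) L (IsCMField.complexConj L) 3).Adelic → ℂ), (∀ z : ℂ, 2 < z.re → Ec z = eisensteinSeriesU (flatSectionU φ z)) →
      (∀ g, DifferentiableOn ℂ (fun z => Ec z g) ({z : ℂ | 1 < z.re} \ (↑({(3 : ℂ) / 2} : Finset ℂ) : Set ℂ))) →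
      ∀ (Fp : (quasiSplit (↥(maximalRealSubfield L)) L (IsCMField.complexConj L) 3).Adelic → ℂ → ℂ), (∀ g, AnalyticAt ℂ (Fp g) ((3 : ℂ) / 2)) → (∀ g, Fp g =ᶠ[𝓝[≠] ((3 : ℂ) / 2)] fun z => (z - (3 : ℂ) / 2) * Ec z g) →
      ∃ f : (quasiSplit (↥(maximalRealSubfield L)) L (IsCMField.complexConj L) 3).L2 μ, (f : (quasiSplit (↥(maximalRealSubfield L)) L (IsCMField.complexConj L) 3).automorphicQuotient → ℂ) =ᵐ[μ] fun x => Fp (Quotient.out (x : (quasiSplit (↥(maximalRealSubfield L)) L (IsCMField.complexConj L) 3).Adelic ⧸ (quasiSplit (↥(maximalRealSubfield L)) L (IsCMField.complexConj L) 3).quotientSubgroup))⁻¹ ((3 : ℂ) / 2)) :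
    ∀ (U₁ : Subgroup ↥(finAdelic (↥(maximalRealSubfield L)) L (IsCMField.complexConj L) 3 ((StdForm.antidiagonal 3).over L))), IsTauLevel L U₁ → ∀ (ψ : (quasiSplit (↥(maximalRealSubfield L)) L (IsCMField.complexConj L) 3).Adelic → ℂ),
      ψ ∈ chiSectionSpacePair χ₁ χ₂ (tauLevel L U₁) ((1 : ↥(tauLevel L U₁) →* ℂ) : ↥(tauLevel L U₁) → ℂ) → Continuous ψ → IsArchFinite L ψ →
      ∃ (Ec : ℂ → (quasiSplit (↥(maximalRealSubfield L)) L (IsCMField.complexConj L) 3).Adelic → ℂ) (Sp : Finset ℂ) (_ : ∀ s ∈ Sp, s.im = 0 ∧ 1 < s.re ∧ s.re ≤ 2)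
        (_ : ∀ g, DifferentiableOn ℂ (fun z => Ec z g) ({z : ℂ | 1 < z.re} \ (↑Sp : Set ℂ))) (_ : ∀ z : ℂ, 2 < z.re → Ec z = eisensteinSeriesU (flatSectionU ψ z))
        (Fp : (quasiSplit (↥(maximalRealSubfield L)) L (IsCMField.complexConj L) 3).Adelic → ℂ → ℂ) (_ : ∀ g, AnalyticAt ℂ (Fp g) ((3 : ℂ) / 2)) (_ : ∀ g, Fp g =ᶠ[𝓝[≠] ((3 : ℂ) / 2)] fun z => (z - (3 : ℂ) / 2) * Ec z g)
        (f : (quasiSplit (↥(maximalRealSubfield L)) L (IsCMField.complexConj L) 3).L2 μ), (f : (quasiSplit (↥(maximalRealSubfield L)) L (IsCMField.complexConj L) 3).automorphicQuotient → ℂ) =ᵐ[μ] fun x => Fp (Quotient.out (x : (quasiSplit (↥(maximalRealSubfield L)) L (IsCMField.complexConj L) 3).Adelic ⧸ (quasiSplit (↥(maximalRealSubfield L)) L (IsCMField.complexConj L) 3).quotientSubgroup))⁻¹ ((3 : ℂ) / 2) := by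
  classical
  intro U₁ hU₁ ψ hψ hψc hψa
  obtain ⟨Ec, P, hPc, hPcd, hPre, hEcE, hEan, -, -⟩ := hTEXP U₁ hU₁ ψ hψ hψc hψa
  obtain ⟨hbddPK, hbdd32⟩ := hPL U₁ hU₁ ψ hψ hψc hψa Ec P hEcE hPcd hEan
  -- the repaired family
  obtain ⟨E', hoff, hon⟩ : ∃ E' : ℂ → (quasiSplit (↥(maximalRealSubfield L)) L (IsCMField.complexConj L) 3).Adelic → ℂ,
      (∀ z g, ¬ (z ∈ P ∧ 1 < z.re ∧ z ≠ (3 : ℂ) / 2) → E' z g = Ec z g) ∧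
      (∀ z g, z ∈ P → 1 < z.re → z ≠ (3 : ℂ) / 2 → E' z g = limUnder (𝓝[≠] z) (fun w => Ec w g)) :=
    ⟨fun z g => if z ∈ P ∧ 1 < z.re ∧ z ≠ (3 : ℂ) / 2 then limUnder (𝓝[≠] z) (fun w => Ec w g) else Ec z g,
      fun z g h => if_neg h, fun z g h1 h2 h3 => if_pos ⟨h1, h2, h3⟩⟩
  have hbddP : ∀ g, ∀ z₀ ∈ P, 1 < z₀.re → z₀ ≠ (3 : ℂ) / 2 → ∃ C : ℝ, ∀ᶠ z in 𝓝[≠] z₀, ‖Ec z g‖ ≤ C := fun g z₀ hz₀P hz₀ hz₀' => by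
    obtain ⟨C, hC⟩ := hbddPK z₀ hz₀P hz₀ hz₀' {g} isCompact_singleton
    exact ⟨C, hC.mono fun z hz => hz g rfl⟩
  have hEd := differentiableOn_slit_of_repaired Ec E' P hPc hPcd hEan hbddP hoff hon
  have hE2' : ∀ z : ℂ, 2 < z.re → E' z = eisensteinSeriesU (flatSectionU ψ z) := repaired_eq_of_two_lt_re Ec E' P hPre hoff hEcE
  obtain ⟨Fp, hF, hFE⟩ := exists_poleLetter_of_repaired Ec E' P hPcd hEan hbdd32 hoff
  obtain ⟨f, hae⟩ := hRES U₁ hU₁ ψ hψ hψc hψa E' hE2' hEd Fp hF hFE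
  refine ⟨E', {(3 : ℂ) / 2}, fun s hs => ?_, hEd, hE2', Fp, hF, hFE, f, hae⟩
  rw [Finset.mem_singleton] at hs
  subst hs
  exact ⟨by norm_num, by norm_num, by norm_num⟩

/-! ## §3 `hTRANSτ` and `hDISC` of record from {`hTEXP`, `hPL`, `hRES`} and (T_∞) -/

section Main

variable (μ : Measure (quasiSplit (↥(maximalRealSubfield L)) L (IsCMField.complexConj L) 3).automorphicQuotient) [(quasiSplit (↥(maximalRealSubfield L)) L (IsCMField.complexConj L) 3).IsAutomorphicMeasure μ] (ξ : OneDimAutRepH L) (μω : HeckeCharacter L)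

/-- **`hTRANSτ` FOR ONE `(L, μ, ξ, μω)` FROM p11's EXPORTS ROW, THE LEDGER ROW, THE RESIDUE ROW AND (T_∞)** (`μω` unitary): ★ `hTRANSτ_of_exports_of_arch` ∘ §2.
[cite: MoeglinWaldspurger1995, II.1.5, IV.1.11, V.3.13] [cite: BorelJacquet1979, §4.1] -/
theorem hTRANSτ_of_exportsRow_of_arch (hμu : μω.IsUnitary)
    (hTEXP : ∀ (U₀ : Subgroup ↥(finAdelic (↥(maximalRealSubfield L)) L (IsCMField.complexConj L) 3 ((StdForm.antidiagonal 3).over L))) (_ : IsTauLevel L U₀)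
      (φ : (quasiSplit (↥(maximalRealSubfield L)) L (IsCMField.complexConj L) 3).Adelic → ℂ) (_ : φ ∈ chiSectionSpacePair (ξ.bcη⁻¹ * ξ.bcψ⁻¹ * μω) ξ.ψ (tauLevel L U₀) ((1 : ↥(tauLevel L U₀) →* ℂ) : ↥(tauLevel L U₀) → ℂ)) (_ : Continuous φ)
      (_ : IsArchFinite L φ),
      ∃ (Ec' : ℂ → (quasiSplit (↥(maximalRealSubfield L)) L (IsCMField.complexConj L) 3).Adelic → ℂ) (P : Set ℂ), IsClosed P ∧ (∀ z₀ : ℂ, ∀ᶠ s in 𝓝[≠] z₀, s ∉ P) ∧ (∀ z ∈ P, z.re ≤ 2) ∧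
        (∀ z : ℂ, 2 < z.re → Ec' z = eisensteinSeriesU (flatSectionU φ z)) ∧ (∀ g (z : ℂ), z ∉ P → AnalyticAt ℂ (fun z => Ec' z g) z) ∧
        (∀ z : ℂ, z ∉ P → Continuous (Ec' z)) ∧
        (∀ z₁ : ℂ, z₁ ∉ P → ∀ K : Set (quasiSplit (↥(maximalRealSubfield L)) L (IsCMField.complexConj L) 3).Adelic, IsCompact K → ∃ V ∈ 𝓝 z₁, ∃ M : ℝ, ∀ z ∈ V, ∀ g ∈ K, ‖Ec' z g‖ ≤ M))
    (hPL : ∀ (U₀ : Subgroup ↥(finAdelic (↥(maximalRealSubfield L)) L (IsCMField.complexConj L) 3 ((StdForm.antidiagonal 3).over L))) (_ : IsTauLevel L U₀)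
      (φ : (quasiSplit (↥(maximalRealSubfield L)) L (IsCMField.complexConj L) 3).Adelic → ℂ) (_ : φ ∈ chiSectionSpacePair (ξ.bcη⁻¹ * ξ.bcψ⁻¹ * μω) ξ.ψ (tauLevel L U₀) ((1 : ↥(tauLevel L U₀) →* ℂ) : ↥(tauLevel L U₀) → ℂ)) (_ : Continuous φ)
      (_ : IsArchFinite L φ)
      (Ec : ℂ → (quasiSplit (↥(maximalRealSubfield L)) L (IsCMField.complexConj L) 3).Adelic → ℂ) (P : Set ℂ), (∀ z : ℂ, 2 < z.re → Ec z = eisensteinSeriesU (flatSectionU φ z)) →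
      (∀ z₀ : ℂ, ∀ᶠ s in 𝓝[≠] z₀, s ∉ P) → (∀ g (z : ℂ), z ∉ P → AnalyticAt ℂ (fun z => Ec z g) z) →
      (∀ z₀ ∈ P, 1 < z₀.re → z₀ ≠ (3 : ℂ) / 2 → ∀ K : Set (quasiSplit (↥(maximalRealSubfield L)) L (IsCMField.complexConj L) 3).Adelic, IsCompact K → ∃ C : ℝ, ∀ᶠ z in 𝓝[≠] z₀, ∀ g ∈ K, ‖Ec z g‖ ≤ C) ∧
      (∀ g, ∃ C : ℝ, ∀ᶠ z in 𝓝[≠] ((3 : ℂ) / 2), ‖(z - (3 : ℂ) / 2) * Ec z g‖ ≤ C))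
    (hRES : ∀ (U₀ : Subgroup ↥(finAdelic (↥(maximalRealSubfield L)) L (IsCMField.complexConj L) 3 ((StdForm.antidiagonal 3).over L))) (_ : IsTauLevel L U₀)
      (φ : (quasiSplit (↥(maximalRealSubfield L)) L (IsCMField.complexConj L) 3).Adelic → ℂ) (_ : φ ∈ chiSectionSpacePair (ξ.bcη⁻¹ * ξ.bcψ⁻¹ * μω) ξ.ψ (tauLevel L U₀) ((1 : ↥(tauLevel L U₀) →* ℂ) : ↥(tauLevel L U₀) → ℂ)) (_ : Continuous φ)
      (_ : IsArchFinite L φ)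
      (Ec : ℂ → (quasiSplit (↥(maximalRealSubfield L)) L (IsCMField.complexConj L) 3).Adelic → ℂ), (∀ z : ℂ, 2 < z.re → Ec z = eisensteinSeriesU (flatSectionU φ z)) →
      (∀ g, DifferentiableOn ℂ (fun z => Ec z g) ({z : ℂ | 1 < z.re} \ (↑({(3 : ℂ) / 2} : Finset ℂ) : Set ℂ))) →
      ∀ (Fp : (quasiSplit (↥(maximalRealSubfield L)) L (IsCMField.complexConj L) 3).Adelic → ℂ → ℂ), (∀ g, AnalyticAt ℂ (Fp g) ((3 : ℂ) / 2)) → (∀ g, Fp g =ᶠ[𝓝[≠] ((3 : ℂ) / 2)] fun z => (z - (3 : ℂ) / 2) * Ec z g) →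
      ∃ f : (quasiSplit (↥(maximalRealSubfield L)) L (IsCMField.complexConj L) 3).L2 μ, (f : (quasiSplit (↥(maximalRealSubfield L)) L (IsCMField.complexConj L) 3).automorphicQuotient → ℂ) =ᵐ[μ] fun x => Fp (Quotient.out (x : (quasiSplit (↥(maximalRealSubfield L)) L (IsCMField.complexConj L) 3).Adelic ⧸ (quasiSplit (↥(maximalRealSubfield L)) L (IsCMField.complexConj L) 3).quotientSubgroup))⁻¹ ((3 : ℂ) / 2))
    (harch : ∀ (U₀ : Subgroup ↥(finAdelic (↥(maximalRealSubfield L)) L (IsCMField.complexConj L) 3 ((StdForm.antidiagonal 3).over L))), IsTauLevel L U₀ → ∀ f ∈ resGMidAtomGenτ L μ ξ μω U₀, ∀ a : ↥(arch (↥(maximalRealSubfield L)) L (IsCMField.complexConj L) 3 ((StdForm.antidiagonal 3).over L)),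
        ((quasiSplit (↥(maximalRealSubfield L)) L (IsCMField.complexConj L) 3).rightRegular μ) (archToAdelic (↥(maximalRealSubfield L)) L (IsCMField.complexConj L) 3 ((StdForm.antidiagonal 3).over L) a) f ∈ (Submodule.span ℂ (⋃ (U₀ : Subgroup ↥(finAdelic (↥(maximalRealSubfield L)) L (IsCMField.complexConj L) 3 ((StdForm.antidiagonal 3).over L))) (_ : IsTauLevel L U₀), resGMidAtomGenτ L μ ξ μω U₀)).topologicalClosure) :
    ∀ g : (quasiSplit (↥(maximalRealSubfield L)) L (IsCMField.complexConj L) 3).Adelic, ∀ f ∈ (⋃ (U₀ : Subgroup ↥(finAdelic (↥(maximalRealSubfield L)) L (IsCMField.complexConj L) 3 ((StdForm.antidiagonal 3).over L))) (_ : IsTauLevel L U₀), resGMidAtomGenτ L μ ξ μω U₀),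
      ((quasiSplit (↥(maximalRealSubfield L)) L (IsCMField.complexConj L) 3).rightRegular μ) g f ∈ (Submodule.span ℂ (⋃ (U₀ : Subgroup ↥(finAdelic (↥(maximalRealSubfield L)) L (IsCMField.complexConj L) 3 ((StdForm.antidiagonal 3).over L))) (_ : IsTauLevel L U₀), resGMidAtomGenτ L μ ξ μω U₀)).topologicalClosure :=
  hTRANSτ_of_exports_of_arch L μ ξ μω hμu (hEXI_of_exportsRow L μ hTEXP hPL hRES) harch

end Main

/-- **`hDISC` OF RECORD FROM {`hW1`, `hTEXP`, `hPL`, `hRES`, `hARCH`}** — conclusion = the `hDISC` binder bytes of ★ `res_midBlock_le_residual_of_letters'` VERBATIM; hypotheses ∀-closed in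
the frame; `hTEXP` in K2E1-p11 (g5)'s bytes (★ `hEXP_tauRow_of_exportsRow`'s hypothesis).  THE LEDGER: `hDISC` = ★ p864527 ∘ ★ §2 ∘ {`hW1`, `hTEXP`, `hPL`, `hRES`, `hARCH`}.
[cite: MoeglinWaldspurger1995, I.2.17–I.2.18, IV.1.11, V.3.13] [cite: Rogawski1990, §13.9 p. 229 (ii)] -/
theorem hDISC_of_exportsRow_of_arch
    (hW1 : ∀ (L : Type) [Field L] [NumberField L] [IsCMField L]
      (μ : Measure (quasiSplit (↥(maximalRealSubfield L)) L (IsCMField.complexConj L) 3).automorphicQuotient) [(quasiSplit (↥(maximalRealSubfield L)) L (IsCMField.complexConj L) 3).IsAutomorphicMeasure μ]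
      (μω : HeckeCharacter L) (_ : μω.IsUnitary) (ξ : OneDimAutRepH L), resGMidBlock L μ ξ μω ≤ resGMidBlockτ L μ ξ μω)
    (hTEXP : ∀ (L : Type) [Field L] [NumberField L] [IsCMField L]
      (μ : Measure (quasiSplit (↥(maximalRealSubfield L)) L (IsCMField.complexConj L) 3).automorphicQuotient) [(quasiSplit (↥(maximalRealSubfield L)) L (IsCMField.complexConj L) 3).IsAutomorphicMeasure μ]
      (μω : HeckeCharacter L) (_ : μω.IsUnitary) (ξ : OneDimAutRepH L), 
      ∀ (U₀ : Subgroup ↥(finAdelic (↥(maximalRealSubfield L)) L (IsCMField.complexConj L) 3 ((StdForm.antidiagonal 3).over L))) (_ : IsTauLevel L U₀)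
        (φ : (quasiSplit (↥(maximalRealSubfield L)) L (IsCMField.complexConj L) 3).Adelic → ℂ) (_ : φ ∈ chiSectionSpacePair (ξ.bcη⁻¹ * ξ.bcψ⁻¹ * μω) ξ.ψ (tauLevel L U₀) ((1 : ↥(tauLevel L U₀) →* ℂ) : ↥(tauLevel L U₀) → ℂ)) (_ : Continuous φ)
        (_ : IsArchFinite L φ),
        ∃ (Ec' : ℂ → (quasiSplit (↥(maximalRealSubfield L)) L (IsCMField.complexConj L) 3).Adelic → ℂ) (P : Set ℂ), IsClosed P ∧ (∀ z₀ : ℂ, ∀ᶠ s in 𝓝[≠] z₀, s ∉ P) ∧ (∀ z ∈ P, z.re ≤ 2) ∧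
          (∀ z : ℂ, 2 < z.re → Ec' z = eisensteinSeriesU (flatSectionU φ z)) ∧ (∀ g (z : ℂ), z ∉ P → AnalyticAt ℂ (fun z => Ec' z g) z) ∧
          (∀ z : ℂ, z ∉ P → Continuous (Ec' z)) ∧
          (∀ z₁ : ℂ, z₁ ∉ P → ∀ K : Set (quasiSplit (↥(maximalRealSubfield L)) L (IsCMField.complexConj L) 3).Adelic, IsCompact K → ∃ V ∈ 𝓝 z₁, ∃ M : ℝ, ∀ z ∈ V, ∀ g ∈ K, ‖Ec' z g‖ ≤ M))
    (hPL : ∀ (L : Type) [Field L] [NumberField L] [IsCMField L]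
      (μ : Measure (quasiSplit (↥(maximalRealSubfield L)) L (IsCMField.complexConj L) 3).automorphicQuotient) [(quasiSplit (↥(maximalRealSubfield L)) L (IsCMField.complexConj L) 3).IsAutomorphicMeasure μ]
      (μω : HeckeCharacter L) (_ : μω.IsUnitary) (ξ : OneDimAutRepH L), 
      ∀ (U₀ : Subgroup ↥(finAdelic (↥(maximalRealSubfield L)) L (IsCMField.complexConj L) 3 ((StdForm.antidiagonal 3).over L))) (_ : IsTauLevel L U₀)
        (φ : (quasiSplit (↥(maximalRealSubfield L)) L (IsCMField.complexConj L) 3).Adelic → ℂ) (_ : φ ∈ chiSectionSpacePair (ξ.bcη⁻¹ * ξ.bcψ⁻¹ * μω) ξ.ψ (tauLevel L U₀) ((1 : ↥(tauLevel L U₀) →* ℂ) : ↥(tauLevel L U₀) → ℂ)) (_ : Continuous φ)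
        (_ : IsArchFinite L φ)
        (Ec : ℂ → (quasiSplit (↥(maximalRealSubfield L)) L (IsCMField.complexConj L) 3).Adelic → ℂ) (P : Set ℂ), (∀ z : ℂ, 2 < z.re → Ec z = eisensteinSeriesU (flatSectionU φ z)) →
        (∀ z₀ : ℂ, ∀ᶠ s in 𝓝[≠] z₀, s ∉ P) → (∀ g (z : ℂ), z ∉ P → AnalyticAt ℂ (fun z => Ec z g) z) →
        (∀ z₀ ∈ P, 1 < z₀.re → z₀ ≠ (3 : ℂ) / 2 → ∀ K : Set (quasiSplit (↥(maximalRealSubfield L)) L (IsCMField.complexConj L) 3).Adelic, IsCompact K → ∃ C : ℝ, ∀ᶠ z in 𝓝[≠] z₀, ∀ g ∈ K, ‖Ec z g‖ ≤ C) ∧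
        (∀ g, ∃ C : ℝ, ∀ᶠ z in 𝓝[≠] ((3 : ℂ) / 2), ‖(z - (3 : ℂ) / 2) * Ec z g‖ ≤ C))
    (hRES : ∀ (L : Type) [Field L] [NumberField L] [IsCMField L]
      (μ : Measure (quasiSplit (↥(maximalRealSubfield L)) L (IsCMField.complexConj L) 3).automorphicQuotient) [(quasiSplit (↥(maximalRealSubfield L)) L (IsCMField.complexConj L) 3).IsAutomorphicMeasure μ]
      (μω : HeckeCharacter L) (_ : μω.IsUnitary) (ξ : OneDimAutRepH L), 
      ∀ (U₀ : Subgroup ↥(finAdelic (↥(maximalRealSubfield L)) L (IsCMField.complexConj L) 3 ((StdForm.antidiagonal 3).over L))) (_ : IsTauLevel L U₀)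
        (φ : (quasiSplit (↥(maximalRealSubfield L)) L (IsCMField.complexConj L) 3).Adelic → ℂ) (_ : φ ∈ chiSectionSpacePair (ξ.bcη⁻¹ * ξ.bcψ⁻¹ * μω) ξ.ψ (tauLevel L U₀) ((1 : ↥(tauLevel L U₀) →* ℂ) : ↥(tauLevel L U₀) → ℂ)) (_ : Continuous φ)
        (_ : IsArchFinite L φ)
        (Ec : ℂ → (quasiSplit (↥(maximalRealSubfield L)) L (IsCMField.complexConj L) 3).Adelic → ℂ), (∀ z : ℂ, 2 < z.re → Ec z = eisensteinSeriesU (flatSectionU φ z)) →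
        (∀ g, DifferentiableOn ℂ (fun z => Ec z g) ({z : ℂ | 1 < z.re} \ (↑({(3 : ℂ) / 2} : Finset ℂ) : Set ℂ))) →
        ∀ (Fp : (quasiSplit (↥(maximalRealSubfield L)) L (IsCMField.complexConj L) 3).Adelic → ℂ → ℂ), (∀ g, AnalyticAt ℂ (Fp g) ((3 : ℂ) / 2)) → (∀ g, Fp g =ᶠ[𝓝[≠] ((3 : ℂ) / 2)] fun z => (z - (3 : ℂ) / 2) * Ec z g) →
        ∃ f : (quasiSplit (↥(maximalRealSubfield L)) L (IsCMField.complexConj L) 3).L2 μ, (f : (quasiSplit (↥(maximalRealSubfield L)) L (IsCMField.complexConj L) 3).automorphicQuotient → ℂ) =ᵐ[μ] fun x => Fp (Quotient.out (x : (quasiSplit (↥(maximalRealSubfield L)) L (IsCMField.complexConj L) 3).Adelic ⧸ (quasiSplit (↥(maximalRealSubfield L)) L (IsCMField.complexConj L) 3).quotientSubgroup))⁻¹ ((3 : ℂ) / 2))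
    (hARCH : ∀ (L : Type) [Field L] [NumberField L] [IsCMField L]
      (μ : Measure (quasiSplit (↥(maximalRealSubfield L)) L (IsCMField.complexConj L) 3).automorphicQuotient) [(quasiSplit (↥(maximalRealSubfield L)) L (IsCMField.complexConj L) 3).IsAutomorphicMeasure μ]
      (μω : HeckeCharacter L) (_ : μω.IsUnitary) (ξ : OneDimAutRepH L), 
      ∀ (U₀ : Subgroup ↥(finAdelic (↥(maximalRealSubfield L)) L (IsCMField.complexConj L) 3 ((StdForm.antidiagonal 3).over L))), IsTauLevel L U₀ → ∀ f ∈ resGMidAtomGenτ L μ ξ μω U₀, ∀ a : ↥(arch (↥(maximalRealSubfield L)) L (IsCMField.complexConj L) 3 ((StdForm.antidiagonal 3).over L)),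
        ((quasiSplit (↥(maximalRealSubfield L)) L (IsCMField.complexConj L) 3).rightRegular μ) (archToAdelic (↥(maximalRealSubfield L)) L (IsCMField.complexConj L) 3 ((StdForm.antidiagonal 3).over L) a) f ∈ (Submodule.span ℂ (⋃ (U₀ : Subgroup ↥(finAdelic (↥(maximalRealSubfield L)) L (IsCMField.complexConj L) 3 ((StdForm.antidiagonal 3).over L))) (_ : IsTauLevel L U₀), resGMidAtomGenτ L μ ξ μω U₀)).topologicalClosure) :
    ∀ (L : Type) [Field L] [NumberField L] [IsCMField L]
      (μ : Measure (quasiSplit (↥(maximalRealSubfield L)) L (IsCMField.complexConj L) 3).automorphicQuotient) [(quasiSplit (↥(maximalRealSubfield L)) L (IsCMField.complexConj L) 3).IsAutomorphicMeasure μ]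
      (μω : HeckeCharacter L) (_ : μω.IsUnitary) (ξ : OneDimAutRepH L), ∀ (E : Submodule ℂ (resGMidBlock L μ ξ μω).toSubmodule)
          (hE : ∀ k, ∀ x ∈ E, ((resGMidBlock L μ ξ μω).toContRep.restrict (((standardMaximalCompactGL 3 L).comap (adelicVal (↥(maximalRealSubfield L)) L (IsCMField.complexConj L) 3 ((StdForm.antidiagonal 3).over L)) : Subgroup (quasiSplit (↥(maximalRealSubfield L)) L (IsCMField.complexConj L) 3).Adelic).subtype)) k x ∈ E), FiniteDimensional ℂ E →
          (((resGMidBlock L μ ξ μω).toContRep.restrict (((standardMaximalCompactGL 3 L).comap (adelicVal (↥(maximalRealSubfield L)) L (IsCMField.complexConj L) 3 ((StdForm.antidiagonal 3).over L)) : Subgroup (quasiSplit (↥(maximalRealSubfield L)) L (IsCMField.complexConj L) 3).Adelic).subtype)).subRep E hE).IsIrreducible →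
          FiniteDimensional ℂ (Representation.homRangeSum ((resGMidBlock L μ ξ μω).toContRep.restrict (((standardMaximalCompactGL 3 L).comap (adelicVal (↥(maximalRealSubfield L)) L (IsCMField.complexConj L) 3 ((StdForm.antidiagonal 3).over L)) : Subgroup (quasiSplit (↥(maximalRealSubfield L)) L (IsCMField.complexConj L) 3).Adelic).subtype)).toRepresentation (((resGMidBlock L μ ξ μω).toContRep.restrict (((standardMaximalCompactGL 3 L).comap (adelicVal (↥(maximalRealSubfield L)) L (IsCMField.complexConj L) 3 ((StdForm.antidiagonal 3).over L)) : Subgroup (quasiSplit (↥(maximalRealSubfield L)) L (IsCMField.complexConj L) 3).Adelic).subtype)).subRep E hE)) :=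
  hDISC_of_exports_of_arch hW1 (fun L _ _ _ μ _ μω hμu ξ => hEXI_of_exportsRow L μ (hTEXP L μ μω hμu ξ) (hPL L μ μω hμu ξ) (hRES L μ μω hμu ξ)) hARCH

end Summit.HodgeConjecture.HodgeConjecture.R90.S8

end
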